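import Summits.AtomisticToContinuum.Crystallization.Theses.MinMeanCycleStackingLock
import Summits.AtomisticToContinuum.Crystallization.Theses.PoissonBesselStacking
import Summits.AtomisticToContinuum.Crystallization.Theses.LuttingerTiszaRegistry
import Summits.AtomisticToContinuum.Crystallization.Theses.PhononSlackCertificates
import Summits.AtomisticToContinuum.Crystallization.Theses.HullMinimality
import Summits.AtomisticToContinuum.Crystallization.Theorems.PhononSlackCertificatesPeriodicGivenLayered
import Summits.AtomisticToContinuum.Crystallization.Theorems.PhononSlackCertificatesWindowOptimality
import Summits.AtomisticToContinuum.Crystallization.Theorems.PhononSlackCertificatesHullBridge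
import Literature.MathematicalPhysics.StatisticalMechanics.LennardJonesThermodynamicLimitProofs
import Literature.MathematicalPhysics.StatisticalMechanics.CrystallizationSymmetries

/-!
# `PeriodicReductionToBarlow` (stmt-AtomisticToContinuum-3062) is DOMINATED by `LayeredWindows` (stmt-11778)

Crux-strategist gen 1 on the crux `PeriodicReductionToBarlow` (route `MinMeanCycleStackingLock`, shared
with `PoissonBesselStacking` / `LuttingerTiszaRegistry`): the TRANSFER heading of the strategy census,
made a theorem.  The hub item `LayeredWindows` (stmt-11778; decls
`HullMinimality.LayeredWindows` = `PhononSlackCertificates.LayeredWindows` verbatim) — every sequence of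
Lennard-Jones ground states has, frequently in `N`, windows of every radius two-way matched with a rigid
image of a LAYERED set (triangular layers of spacing `a ∈ [47/50, 1]` in hole registry, free Hägg word,
free spacings in `[39a/50, 17a/20]`) — implies the crux:

* `exists_isGroundState_lennardJones` (Literature, proved): a ground-state sequence `x` exists;
* the LANDED stubs of the proved sibling `PeriodicGivenLayered` (stmt-11779, namespace
  `Theorems.LayeredHull`: `stub_extraction`, `stub_recurrence`, `stub_windowBounds`, `stub_closing` with
  `stub_registry` / `stub_convexity` / `stub_layerCake`) turn the layered windows of `x` into ONE
  fault-free, equally spaced layered set in the hull of `x`;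
* `readoff_explicit` (here; the proof of `LayeredHull.pgl_readoff` with the witness kept): that set is
  the point set of `P = A((barlowPeriodicConfiguration s' a h 2) + z'₀ e₃)` with `a ∈ [47/50, 1]`,
  `h = z' 1 − z' 0 ∈ [39a/50, 17a/20]` — parameters IN THE BOX `B` — and `e(P) = e(barlow s' a h)`
  (`energyPerParticle_isometryImage`, `energyPerParticle_translate`);
* the LANDED `windowOptimality_proof` (stmt-13962): a periodic configuration in the hull of a
  ground-state sequence has LEAST energy per particle among all periodic configurations.

Hence `∀ Q, e(barlowPeriodicConfiguration s' a h 2) ≤ e(Q)` with `(a, h) ∈ B`: the crux, with a witness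
that does not even depend on `Q`.  Consequently (landed `HullBridgeExact.hullBridge_proof`, stmt-15147)
the crux also follows from `CoerciveTwoShellGap` (13956) ∧ `NearFieldConvexity` (13958).

Nothing here closes an item: `LayeredWindows` is open.  The point is organisational and exact: item 3062
needs no independent proof once 11778 (or 13956 + 13958) lands — `periodicReductionToBarlow_of_layeredWindows`
closes it in one line.  All `[folklore]` given the cited tree theorems.
-/

noncomputable section

namespace Summit.AtomisticToContinuum.Crystallization.Cruxes.PeriodicReductionToBarlow.HullShadow

open Filter Literature.MathematicalPhysics.StatisticalMechanics
open Summit.AtomisticToContinuum.Crystallization.Theorems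
open Summit.AtomisticToContinuum.Crystallization.Theorems.LayeredHull

local notation "E3" => EuclideanSpace ℝ (Fin 3)

/-- **Explicit read-off** (the proof of `LayeredHull.pgl_readoff`, keeping the witness): a fault-free
(`s (m+1) = −s m`), equally spaced layered set `A(S(a, s, z))` is the point set of the isometric image under
`A` of the translate by `z 0 • e₃` of `barlowPeriodicConfiguration s` (period `2`, in-layer spacing `a`,
layer spacing `h = z 1 − z 0`), and that periodic configuration has the same Lennard-Jones energy per
particle as `barlowPeriodicConfiguration s` itself. [folklore] -/
theorem readoff_explicit (a : ℝ) (ha : 47 / 50 ≤ a) (A : E3 →ₗᵢ[ℝ] E3) (s : ℤ → ℤ) (z : ℤ → ℝ)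
    (hz : ∀ m : ℤ, 39 / 50 * a ≤ z (m + 1) - z m ∧ z (m + 1) - z m ≤ 17 / 20 * a)
    (h1 : ∀ m : ℤ, s (m + 1) = -s m) (h2 : ∀ m : ℤ, z (m + 2) - z (m + 1) = z (m + 1) - z m) :
    ∃ (ha0 : a ≠ 0) (hh0 : z 1 - z 0 ≠ 0) (hs2 : ∀ i : ℤ, s (i + 2) = s i),
      ∃ P : PeriodicConfiguration 3,
        P.energyPerParticle lennardJones =
          (barlowPeriodicConfiguration s ha0 hh0 two_ne_zero hs2).energyPerParticle lennardJones ∧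
        P.points = {p | ∃ m i j : ℤ, p = A (((i : ℝ) • triangularVec₁ a) +
          ((j : ℝ) • triangularVec₂ a) + ((haggLabel s m : ℝ) • barlowOffset a) + (z m • layerNormal 1))} := by
  -- the common increment `h = z 1 - z 0 > 0` and the arithmetic progression of heights
  set h : ℝ := z 1 - z 0 with hh_def
  have ha0 : a ≠ 0 := by intro h0; rw [h0] at ha; norm_num at ha
  have hh0 : h ≠ 0 := by
    have := (hz 0).1
    simp only [zero_add] at this
    intro h0; rw [hh_def] at h0; nlinarith
  have hstep : ∀ m : ℤ, z (m + 1) - z m = h := by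
    have hup : ∀ n : ℕ, z ((n : ℤ) + 1) - z n = h := by
      intro n
      induction n with
      | zero => simp [hh_def]
      | succ n ih =>
        have := h2 (n : ℤ)
        push_cast at this ih ⊢
        have e : (n : ℤ) + 1 + 1 = (n : ℤ) + 2 := by ring
        rw [e]
        linarith
    have hdown : ∀ n : ℕ, z (-(n : ℤ) + 1) - z (-(n : ℤ)) = h := by
      intro n
      induction n with
      | zero => simp [hh_def]
      | succ n ih =>
        have := h2 (-((n : ℤ) + 1))
        push_cast at this ih ⊢
        have e1 : -((n : ℤ) + 1) + 2 = -(n : ℤ) + 1 := by ring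
        have e2 : -((n : ℤ) + 1) + 1 = -(n : ℤ) := by ring
        rw [e1, e2] at this
        rw [e2]
        linarith
    intro m
    rcases le_or_gt 0 m with hm | hm
    · obtain ⟨n, rfl⟩ := Int.eq_ofNat_of_zero_le hm
      exact hup n
    · obtain ⟨n, hn⟩ := Int.exists_eq_neg_ofNat (le_of_lt hm)
      rw [hn]
      exact hdown n
  have harith : ∀ m : ℤ, z m = z 0 + m * h := by
    have hup : ∀ n : ℕ, z n = z 0 + n * h := by
      intro n
      induction n with
      | zero => simp
      | succ n ih =>
        have := hstep n
        push_cast at this ⊢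
        linarith
    have hdown : ∀ n : ℕ, z (-(n : ℤ)) = z 0 + (-(n : ℤ)) * h := by
      intro n
      induction n with
      | zero => simp
      | succ n ih =>
        have := hstep (-((n : ℤ) + 1))
        have e2 : -((n : ℤ) + 1) + 1 = -(n : ℤ) := by ring
        rw [e2] at this
        push_cast at this ih ⊢
        linarith
    intro m
    rcases le_or_gt 0 m with hm | hm
    · obtain ⟨n, rfl⟩ := Int.eq_ofNat_of_zero_le hm
      exact_mod_cast hup n
    · obtain ⟨n, hn⟩ := Int.exists_eq_neg_ofNat (le_of_lt hm)
      rw [hn]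
      exact_mod_cast hdown n
  -- `s` has period `2`
  have hs2 : ∀ i : ℤ, s (i + 2) = s i := fun i => by
    rw [show i + 2 = i + 1 + 1 by ring, h1, h1, neg_neg]
  -- the periodic configuration
  have key : ∀ m i j : ℤ, ((i : ℝ) • triangularVec₁ a) + ((j : ℝ) • triangularVec₂ a) +
      ((haggLabel s m : ℝ) • barlowOffset a) + (z m • layerNormal 1) =
      barlowPos a h s m i j + z 0 • layerNormal 1 := by
    intro m i j
    rw [barlowPos, harith m, pgl_layerNormal_eq_smul h, smul_smul]
    module
  let Ae : E3 ≃ₗᵢ[ℝ] E3 := A.toLinearIsometryEquiv rfl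
  have hAe : ∀ p : E3, Ae p = A p := fun p => rfl
  refine ⟨ha0, hh0, hs2, ((barlowPeriodicConfiguration s ha0 hh0 two_ne_zero hs2).translate
    (z 0 • layerNormal 1)).isometryImage Ae, ?_, ?_⟩
  · rw [PeriodicConfiguration.energyPerParticle_isometryImage,
      PeriodicConfiguration.energyPerParticle_translate]
  ext q
  rw [PeriodicConfiguration.mem_points_isometryImage, PeriodicConfiguration.mem_points_translate,
    barlowPeriodicConfiguration_points, mem_barlowStacking_iff]
  simp only [Set.mem_setOf_eq]
  constructor
  · rintro ⟨k, i, j, hk⟩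
    refine ⟨k, i, j, ?_⟩
    rw [sub_eq_iff_eq_add] at hk
    have : q = Ae (Ae.symm q) := (Ae.apply_symm_apply q).symm
    rw [this, hk, hAe, key]
  · rintro ⟨m, i, j, rfl⟩
    refine ⟨m, i, j, ?_⟩
    rw [← hAe, Ae.symm_apply_apply, sub_eq_iff_eq_add, key]

/-- **Domination.** `LayeredWindows` (stmt-11778, the `PhononSlackCertificates` copy) implies the crux
`PeriodicReductionToBarlow` (stmt-3062, the `MinMeanCycleStackingLock` copy): the hull of any ground-state
sequence contains a fault-free equally spaced layered set, i.e. a uniform Barlow stacking with parameters in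
the box `B`, and periodic configurations in the hull of ground states have least energy per particle.
[folklore] -/
theorem periodicReductionToBarlow_of_layeredWindows
    (hLW : Summit.AtomisticToContinuum.Crystallization.Theses.PhononSlackCertificates.LayeredWindows) :
    Summit.AtomisticToContinuum.Crystallization.Theses.MinMeanCycleStackingLock.PeriodicReductionToBarlow := by
  -- a sequence of Lennard-Jones ground states
  have hex : ∀ N : ℕ, ∃ y : Fin N → E3, IsGroundState lennardJones y :=
    fun N => exists_isGroundState_lennardJones (by norm_num) N
  choose x hx using hex
  -- its layered windows (the hypothesis), one layered set in the hull, a recurrent one, the closing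
  obtain ⟨a, ha, ha1, hW⟩ := hLW x hx
  obtain ⟨A, s, z, hs, hz, hH⟩ := stub_extraction x a ha ha1 hW
  obtain ⟨s', z', hs', hz', hrec, hH'⟩ := stub_recurrence x a ha ha1 A s z hs hz hH
  obtain ⟨hU, hL⟩ := stub_windowBounds
  obtain ⟨hfault, hconst⟩ := stub_closing x hx a ha ha1 A s' z' hs' hz' hrec hH' hU hL stub_registry
    stub_convexity stub_layerCake
  -- read off the uniform Barlow stacking in the box
  obtain ⟨ha0, hh0, hs2, P, hPe, hPpts⟩ := readoff_explicit a ha A s' z' hz' hfault hconst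
  -- windows of ground states are optimal
  have hopt := windowOptimality_proof
  unfold Summit.AtomisticToContinuum.Crystallization.Theses.PhononSlackCertificates.WindowOptimality at hopt
  have hleast := hopt x hx P (by rw [hPpts]; exact hH')
  intro Q
  refine ⟨a, z' 1 - z' 0, ha, ha1, ?_, ?_, s', 2, ha0, hh0, two_ne_zero, hs2, hs', ?_⟩
  · have := (hz' 0).1
    simpa using this
  · have := (hz' 0).2
    simpa using this
  · rw [← hPe]
    exact hleast.2 ⟨Q, rfl⟩

/-- The same domination, hypothesis as the `HullMinimality` copy of item 11778 (verbatim statement). -/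
theorem periodicReductionToBarlow_of_layeredWindows'
    (hLW : Summit.AtomisticToContinuum.Crystallization.Theses.HullMinimality.LayeredWindows) :
    Summit.AtomisticToContinuum.Crystallization.Theses.MinMeanCycleStackingLock.PeriodicReductionToBarlow :=
  periodicReductionToBarlow_of_layeredWindows hLW

/-- The shared copies of the crux (identical signatures): `PoissonBesselStacking.PeriodicReductionToBarlow`. -/
theorem periodicReductionToBarlowPBS_of_layeredWindows
    (hLW : Summit.AtomisticToContinuum.Crystallization.Theses.PhononSlackCertificates.LayeredWindows) :
    Summit.AtomisticToContinuum.Crystallization.Theses.PoissonBesselStacking.PeriodicReductionToBarlow :=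
  periodicReductionToBarlow_of_layeredWindows hLW

/-- The shared copies of the crux (identical signatures): `LuttingerTiszaRegistry.PeriodicReductionToBarlow`. -/
theorem periodicReductionToBarlowLT_of_layeredWindows
    (hLW : Summit.AtomisticToContinuum.Crystallization.Theses.PhononSlackCertificates.LayeredWindows) :
    Summit.AtomisticToContinuum.Crystallization.Theses.LuttingerTiszaRegistry.PeriodicReductionToBarlow :=
  periodicReductionToBarlow_of_layeredWindows hLW

/-- **Corollary (via the landed bridge `HullBridgeExact.hullBridge_proof`, stmt-15147).**  The two open
cruxes of route `PhononSlackCertificates` already imply the crux of this route: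
`CoerciveTwoShellGap → NearFieldConvexity → PeriodicReductionToBarlow`. [folklore] -/
theorem periodicReductionToBarlow_of_twoShellGap_of_nearField
    (hG : Summit.AtomisticToContinuum.Crystallization.Theses.PhononSlackCertificates.CoerciveTwoShellGap)
    (hN : Summit.AtomisticToContinuum.Crystallization.Theses.PhononSlackCertificates.NearFieldConvexity) :
    Summit.AtomisticToContinuum.Crystallization.Theses.MinMeanCycleStackingLock.PeriodicReductionToBarlow := by
  have hB := Summit.AtomisticToContinuum.Crystallization.Theorems.HullBridgeExact.hullBridge_proof
  unfold Summit.AtomisticToContinuum.Crystallization.Theses.PhononSlackCertificates.HullBridge at hB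
  exact periodicReductionToBarlow_of_layeredWindows (hB hG hN)

end Summit.AtomisticToContinuum.Crystallization.Cruxes.PeriodicReductionToBarlow.HullShadow

end
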